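import Mathlib
import Literature.Probability.Percolation.CircuitTriples
import Literature.Probability.Percolation.TriLatticeRounding
import Literature.Probability.Percolation.FullPlaneCNLProofs
import Summits.CriticalPhenomena.CardyFormulaZ2.Theorems.CardyMagicRigidityDefs
import Summits.CriticalPhenomena.CardyFormulaZ2.Theorems.CardyMagicRigidityLoopLimitZ2EqTSiteEndOuterBoundary
import Summits.CriticalPhenomena.CardyFormulaZ2.Theorems.CardyMagicRigidityNestingRigiditySiteColourFlip
import HarnessLib

/-!
# Lattice dust density (Dlat), site-`𝕋` half: mesoscopic loops of both types are dense in `tEns`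

Crux `Summit.CriticalPhenomena.CardyFormulaZ2.Theses.CardyMagicRigidity.NestingRigidity`
(stmt-CriticalPhenomena-4835), line `positive-cone-weight-doubling`, registered stub
`latticeDust_latticeEnsembles` (the lattice dust density consumed by
`tamePrecompact_tEns_of_ae_tame_separating_of_latticeDust`).  This brick is the site-`𝕋` half in LOCAL
form (registered anchor `latticeDust_local_tEns`): for every radius `ρ > 0` and `κ > 0` there is `d > 0`
such that for all small meshes `δ` and EVERY centre `y`, off an event of probability `≤ κ`, the disc
`B(y, ρ)` contains a member of each type of `tEns.X δ ω = siteLoopConfig δ ω` of diameter `≥ d`.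

Proof (pure RSW + the loops ↔ clusters dictionary, no cited fact):
* §1 deterministic: an OPEN blocking circuit of `𝕋` in `4R < ‖· - c‖ < 8R` inside a CLOSED blocking
  circuit in `16R < ‖· - c‖ < 32R` forces a member of TYPE `1` with trace in `B(δc, δ(32R + 2))` and
  diameter `≥ 4Rδ`: the open cluster of the open circuit cannot cross the closed one, so it is finite
  and within `32R` of `c`; its outer boundary is a type-`1` interface loop
  (`siteEnd_exists_loop_of_finite`, …LoopLimitZ2EqTSiteEndOuterBoundary) winding once about every site
  of the cluster, in particular about the two sites where the circuit meets the lattice line through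
  `c` (at distance `> 8Rδ`), and a polygon winding about two points at distance `D` has diameter
  `≥ D/2` (`loopWind_eq_zero_of_lt_dist`).  The colour flip `ω ↦ ωᶜ` turns this into a member of type
  `0` (`mem_siteLoopConfig_compl_iff`).
* §2 probability: both circuits are part of the tree's `circuitTriple c R`, which occurs at some of
  `m` geometric scales with probability `≥ 1 - (1 - c₀³)^m` (`real_iInter_compl_circuitTriple_le`,
  Bollobás–Riordan RSW circuits `exists_pos_le_real_circuitAround`); the colour-flipped event has the
  same probability (`triSitePercolation_half_real_preimage_compl`).
-/

noncomputable section

open MeasureTheory Set Filter Metric TopologicalSpace Function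
open scoped Topology ENNReal NNReal unitInterval

namespace Summit.CriticalPhenomena.CardyFormulaZ2.Cruxes.NestingRigidity.PositiveConeWeightDoubling

open Literature.Probability.RandomPlanarGeometry Literature.Probability.Percolation
  Literature.Probability.LatticeModels
open Summit.CriticalPhenomena.CardyFormulaZ2.Cruxes.NestingRigidity.RingCloudTomography
open Summit.CriticalPhenomena.CardyFormulaZ2.Cruxes.NestingRigidity.MarkovCascadeOneGeneration
  (mem_siteLoopConfig_compl_iff)
open Summit.CriticalPhenomena.CardyFormulaZ2.Cruxes.LoopLimitZ2EqT.HexSegment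
  (siteEnd_exists_loop_of_finite)

/-! ## §1 Deterministic: nested circuits of opposite colours force a typed macroscopic loop -/

/-- **A polygon winding about two points has diameter at least half their distance**: if the closed
honeycomb polygon of `w` at mesh `δ` winds non-trivially about `p` and about `q`, then
`dist p q ≤ 2 · diam (trace)` (the polygon does not wind about points farther than its diameter from a
trace point, `loopWind_eq_zero_of_lt_dist`). -/
theorem latticeDust_dist_le_two_mul_diam_polyTrace {f₀ : HexVertex} {w : hexGraph.Walk f₀ f₀}
    (hlen : 0 < w.length) {δ : ℝ} {p q : ℂ} (hp : loopWind δ w p ≠ 0) (hq : loopWind δ w q ≠ 0) :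
    dist p q ≤ 2 * diam (polyTrace δ w) := by
  have hcpt : IsCompact (polyTrace δ w) := by
    rw [← range_loopPath hlen]; exact isCompact_range (loopPath δ w).continuous
  have hz₀ : (loopPath δ w) 0 ∈ polyTrace δ w := by
    rw [← range_loopPath hlen]; exact mem_range_self _
  set z₀ : ℂ := (loopPath δ w) 0
  have hsub : polyTrace δ w ⊆ closedBall z₀ (diam (polyTrace δ w)) := fun y hy ↦
    mem_closedBall.2 (dist_le_diam_of_mem hcpt.isBounded hy hz₀)
  have hpz : dist p z₀ ≤ diam (polyTrace δ w) :=
    not_lt.1 fun h ↦ hp (loopWind_eq_zero_of_lt_dist hlen hsub h)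
  have hqz : dist q z₀ ≤ diam (polyTrace δ w) :=
    not_lt.1 fun h ↦ hq (loopWind_eq_zero_of_lt_dist hlen hsub h)
  linarith [dist_triangle_right p q z₀]

/-- **Open circuit inside a closed circuit ⇒ a macroscopic member of type `1`.**  If `ω` has an open
blocking circuit around `c` in `(4R, 8R)` and a closed one in `(16R, 32R)` (`R > 0`, lattice units),
then at every mesh `δ > 0` some member of type `1` of `siteLoopConfig δ ω` has its trace in
`B(δc, δ(32R + 2))` and diameter `≥ 4Rδ` (the outer boundary of the open cluster of the open circuit). -/
theorem latticeDust_typeOne_of_circuits {ω : SiteConfig (Site 2)} {c : Site 2} {R : ℝ} (hR : 0 < R)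
    {δ : ℝ} (hδ : 0 < δ) (hO : ω ∈ triOpenCircuitAround c (4 * R) (8 * R))
    (hC : ω ∈ triClosedCircuitAround c (16 * R) (32 * R)) :
    ∃ u ∈ (siteLoopConfig δ ω).F 1,
      u.range ⊆ ball (triMeshPoint δ c) (δ * (32 * R + 2)) ∧ δ * (4 * R) ≤ diam u.range := by
  classical
  obtain ⟨p₀, O, hOs, hOb⟩ := hO
  obtain ⟨vC, C, hCs, hCb⟩ := mem_triClosedCircuitAround_iff.1 hC
  have hp₀ω : p₀ ∈ ω := (hOs p₀ O.start_mem_support).1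
  -- the open cluster of `p₀` is confined by the closed circuit
  set K : Set (Site 2) := {x | PathIn triGraph ω p₀ x} with hK
  have hKnorm : ∀ x ∈ K, ‖triEmbed (x - c)‖ < 32 * R := by
    intro x hx
    refine not_le.1 fun hge ↦ ?_
    obtain ⟨q, hq⟩ := PathIn.exists_walk hx
    obtain ⟨z, hzq, hzC⟩ := hCb p₀ x q (by linarith [(hOs p₀ O.start_mem_support).2.2]) hge
    exact (hCs z hzC).1 (hq z hzq)
  have hKfin : K.Finite := by
    refine (Finset.finite_toSet (box 2 ⌈2 * (32 * R + ‖triEmbed c‖)⌉₊)).subset fun x hx ↦ ?_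
    refine Finset.mem_coe.2 (mem_box_of_norm_triEmbed_le ?_)
    have e : triEmbed x = triEmbed (x - c) + triEmbed c := by rw [← triEmbed_add, sub_add_cancel]
    rw [e]
    exact (norm_add_le _ _).trans (by linarith [hKnorm x hx])
  obtain ⟨F, w, hw, hpos, hlv⟩ := siteEnd_exists_loop_of_finite hp₀ω hKfin
  have hlen : 0 < w.length := by have := hw.isCycle.three_le_length; omega
  have hrange : (UnbasedLoop.mk (BasedLoop.mk (siteLoopCurve δ w) (isLoop_siteLoopCurve δ w))).range =
      polyTrace δ w := by
    rw [range_mk_siteLoopCurve]; exact range_toCurve_eq_polyTrace hlen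
  refine ⟨UnbasedLoop.mk (BasedLoop.mk (siteLoopCurve δ w) (isLoop_siteLoopCurve δ w)),
    ⟨F, w, hw, ⟨fun _ ↦ hpos, fun _ ↦ rfl⟩, rfl⟩, ?_, ?_⟩
  · -- localisation: the trace is within `δ` of the left sites, which lie in the cluster
    rw [hrange]
    intro z hz
    obtain ⟨i, hi, hzi⟩ := mem_polyTrace_iff.1 hz
    have h1 : dist z (triMeshPoint δ (hw.lv i)) ≤ δ := hw.polyPiece_subset_closedBall hδ.le hi hzi
    have h2 : dist (triMeshPoint δ (hw.lv i)) (triMeshPoint δ c) < δ * (32 * R) := by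
      rw [dist_triMeshPoint_eq hδ.le]; exact mul_lt_mul_of_pos_left (hKnorm _ (hlv i hi)) hδ
    rw [mem_ball]
    calc dist z (triMeshPoint δ c)
        ≤ dist z (triMeshPoint δ (hw.lv i)) + dist (triMeshPoint δ (hw.lv i)) (triMeshPoint δ c) :=
          dist_triangle _ _ _
      _ < δ + δ * (32 * R) := add_lt_add_of_le_of_lt h1 h2
      _ ≤ δ * (32 * R + 2) := by nlinarith
  · -- size: the loop winds once about every site of the cluster, which meets both rays from `c`
    have hW : ∀ x ∈ K, loopWind δ w (triMeshPoint δ x) = 1 := by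
      intro x hx
      have h0 : PathIn triGraph ω (hw.lv 0) x := (hlv 0 hlen).symm.trans hx
      rw [← hw.loopWind_eq_of_pathIn_of_mem hδ h0]
      exact hw.loopWind_leftPt_eq_one_of_shoelace_pos hδ hpos hlen
    have hOK : ∀ z ∈ O.support, z ∈ K := fun z hz ↦
      (PathIn.of_walk_mem_support O (fun x hx ↦ (hOs x hx).1) hz).1
    set J : ℕ := ⌈8 * R⌉₊ with hJ
    have hJ' : 8 * R ≤ (J : ℝ) := Nat.le_ceil _
    -- the positive ray
    obtain ⟨qp, hqp⟩ := exists_walk_raySite c J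
    obtain ⟨zp, hzpq, hzpO⟩ := hOb (raySite c 0) (raySite c J) qp
      (by rw [norm_triEmbed_raySite_self_sub, Nat.cast_zero]; linarith)
      (by rw [norm_triEmbed_raySite_self_sub]; exact hJ')
    obtain ⟨kp, -, rfl⟩ := hqp zp hzpq
    have hkp : 4 * R < (kp : ℝ) := by
      have := (hOs _ hzpO).2.1; rwa [norm_triEmbed_raySite_self_sub] at this
    -- the negative ray
    obtain ⟨qm, hqm⟩ := exists_walk_raySiteNeg c J
    obtain ⟨zm, hzmq, hzmO⟩ := hOb (raySiteNeg c 0) (raySiteNeg c J) qm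
      (by rw [norm_triEmbed_raySiteNeg_self_sub, Nat.cast_zero]; linarith)
      (by rw [norm_triEmbed_raySiteNeg_self_sub]; exact hJ')
    obtain ⟨km, -, rfl⟩ := hqm zm hzmq
    have hkm : 4 * R < (km : ℝ) := by
      have := (hOs _ hzmO).2.1; rwa [norm_triEmbed_raySiteNeg_self_sub] at this
    -- distance of the two sites
    have hd : dist (triMeshPoint δ (raySite c kp)) (triMeshPoint δ (raySiteNeg c km)) = δ * (kp + km) := by
      rw [dist_triMeshPoint_eq hδ.le, show raySite c kp - raySiteNeg c km =
        (raySite c kp - c) - (raySiteNeg c km - c) by abel, triEmbed_sub, triEmbed_raySite_sub,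
        triEmbed_raySiteNeg_sub, sub_self, triEmbed_zero]
      congr 1
      rw [show (0 : ℂ) + kp - (0 - km) = ((kp + km : ℕ) : ℂ) by push_cast; ring, Complex.norm_natCast]
      push_cast; ring
    have hnep : loopWind δ w (triMeshPoint δ (raySite c kp)) ≠ 0 := by
      rw [hW _ (hOK _ hzpO)]; exact one_ne_zero
    have hnem : loopWind δ w (triMeshPoint δ (raySiteNeg c km)) ≠ 0 := by
      rw [hW _ (hOK _ hzmO)]; exact one_ne_zero
    have key := latticeDust_dist_le_two_mul_diam_polyTrace hlen hnep hnem
    rw [hrange]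
    rw [hd] at key
    have : δ * (8 * R) < δ * (kp + km) := mul_lt_mul_of_pos_left (by linarith) hδ
    linarith

/-- **Closed circuit inside an open circuit ⇒ a macroscopic member of type `0`** (colour flip of
`latticeDust_typeOne_of_circuits`: a type-`1` member of `siteLoopConfig δ ωᶜ` is, reversed, a type-`0`
member of `siteLoopConfig δ ω`, `mem_siteLoopConfig_compl_iff`, with the same trace). -/
theorem latticeDust_typeZero_of_circuits_compl {ω : SiteConfig (Site 2)} {c : Site 2} {R : ℝ}
    (hR : 0 < R) {δ : ℝ} (hδ : 0 < δ) (hO : ωᶜ ∈ triOpenCircuitAround c (4 * R) (8 * R))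
    (hC : ωᶜ ∈ triClosedCircuitAround c (16 * R) (32 * R)) :
    ∃ u ∈ (siteLoopConfig δ ω).F 0,
      u.range ⊆ ball (triMeshPoint δ c) (δ * (32 * R + 2)) ∧ δ * (4 * R) ≤ diam u.range := by
  obtain ⟨u, hu, h1, h2⟩ := latticeDust_typeOne_of_circuits hR hδ hO hC
  refine ⟨u.reverse, ?_, by rwa [UnbasedLoop.range_reverse], by rwa [UnbasedLoop.range_reverse]⟩
  have := (mem_siteLoopConfig_compl_iff δ ω 1 u).1 hu
  simpa using this

/-- **A circuit triple of `ω` or of `ωᶜ` gives macroscopic members of the corresponding type**: for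
`i = 1` from `ω ∈ circuitTriple c R`, for `i = 0` from `ωᶜ ∈ circuitTriple c R`. -/
theorem latticeDust_typed_of_circuitTriple {ω : SiteConfig (Site 2)} {c : Site 2} {R : ℝ} (hR : 0 < R)
    {δ : ℝ} (hδ : 0 < δ) (i : Fin 2)
    (h : (if i = 1 then ω else ωᶜ) ∈ circuitTriple c R) :
    ∃ u ∈ (siteLoopConfig δ ω).F i,
      u.range ⊆ ball (triMeshPoint δ c) (δ * (32 * R + 2)) ∧ δ * (4 * R) ≤ diam u.range := by
  fin_cases i
  · simp only [Fin.zero_eta, zero_ne_one, if_false] at h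
    exact latticeDust_typeZero_of_circuits_compl hR hδ h.1.1 h.1.2
  · simp only [Fin.mk_one, if_true] at h
    exact latticeDust_typeOne_of_circuits hR hδ h.1.1 h.1.2


/-! ## §2 Probability: circuit triples of `ω` and of `ωᶜ` at one of many scales -/

/-- The colour flip is measurable on site configurations. -/
theorem latticeDust_measurable_compl : Measurable (compl : SiteConfig (Site 2) → SiteConfig (Site 2)) :=
  measurable_set_iff.2 fun i ↦ (measurable_set_mem i).not

/-- **No circuit triple at `m` consecutive geometric scales, for `ω` or for `ωᶜ`, has probability
`≤ 2 (1 - c₀³)^m`** at `p = 1/2` (`real_iInter_compl_circuitTriple_le` and the colour-flip symmetry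
`triSitePercolation_half_real_preimage_compl`). -/
theorem latticeDust_real_bad_le {c₀ : ℝ}
    (h : ∀ (c : Site 2) (R : ℝ), 1000 ≤ R →
      c₀ ≤ (triSitePercolation half).real (triOpenCircuitAround c R (2 * R)) ∧
        c₀ ≤ (triSitePercolation half).real (triClosedCircuitAround c R (2 * R)))
    (hc₀ : 0 ≤ c₀) (c : Site 2) {R₀ : ℝ} (hR₀ : 250 ≤ R₀) (m : ℕ) :
    (triSitePercolation half).real
        ((⋂ i < m, (circuitTriple c (circuitScale R₀ (0 + i)))ᶜ) ∪
          compl ⁻¹' (⋂ i < m, (circuitTriple c (circuitScale R₀ (0 + i)))ᶜ)) ≤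
      2 * (1 - c₀ ^ 3) ^ m := by
  have h1 := real_iInter_compl_circuitTriple_le h hc₀ c hR₀ 0 m
  have h2 : (triSitePercolation half).real
      (compl ⁻¹' (⋂ i < m, (circuitTriple c (circuitScale R₀ (0 + i)))ᶜ)) ≤ (1 - c₀ ^ 3) ^ m := by
    rw [triSitePercolation_half_real_preimage_compl]; exact h1
  calc _ ≤ (triSitePercolation half).real (⋂ i < m, (circuitTriple c (circuitScale R₀ (0 + i)))ᶜ) +
        (triSitePercolation half).real
          (compl ⁻¹' (⋂ i < m, (circuitTriple c (circuitScale R₀ (0 + i)))ᶜ)) :=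
        measureReal_union_le _ _
    _ ≤ (1 - c₀ ^ 3) ^ m + (1 - c₀ ^ 3) ^ m := add_le_add h1 h2
    _ = 2 * (1 - c₀ ^ 3) ^ m := by ring

/-- **Registered anchor `latticeDust_local_tEns` — lattice dust density of `tEns`, local form.**  For
every `ρ > 0` and `κ > 0` there is `d > 0` such that for all small meshes `δ` and every centre `y`, off
an event of probability `≤ κ`, the disc `B(y, ρ)` contains a member of each type of `tEns.X δ ω` of
diameter `≥ d`.  (RSW circuit triples at `m` scales inside `B(y, ρ)` for `ω` and `ωᶜ`, §2, and the
deterministic §1.) -/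
theorem latticeDust_local_tEns : ∀ (ρ κ : ℝ), 0 < ρ → 0 < κ → ∃ d : ℝ, 0 < d ∧
    ∀ᶠ δ in 𝓝[>] (0 : ℝ), ∀ y : ℂ, ∃ G : Set tEns.Ω, MeasurableSet G ∧ tEns.P Gᶜ ≤ ENNReal.ofReal κ ∧
      ∀ ω ∈ G, ∀ i : Fin 2, ∃ v ∈ (tEns.X δ ω).F i, v.range ⊆ ball y ρ ∧ d ≤ diam v.range := by
  intro ρ κ hρ hκ
  obtain ⟨c₀, hc₀, hcirc⟩ := exists_pos_le_real_circuitAround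
  have hc₀1 : c₀ ≤ 1 := ((hcirc 0 1000 le_rfl).1).trans measureReal_le_one
  have hθ0 : 0 ≤ 1 - c₀ ^ 3 := by nlinarith [pow_le_one₀ hc₀.le hc₀1 (n := 3)]
  have hθ1 : 1 - c₀ ^ 3 < 1 := by nlinarith [pow_pos hc₀ 3]
  obtain ⟨m, hm⟩ := exists_pow_lt_of_lt_one (half_pos hκ) hθ1
  set A : ℝ := 1024 ^ m with hA
  have hA1 : 1 ≤ A := one_le_pow₀ (by norm_num)
  set r₁ : ℝ := ρ / (128 * A) with hr₁
  have hr₁pos : 0 < r₁ := by positivity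
  have hr₁A : 32 * r₁ * A = ρ / 4 := by rw [hr₁]; field_simp; ring
  refine ⟨4 * r₁, by positivity, ?_⟩
  have hev : ∀ᶠ δ in 𝓝[>] (0 : ℝ), δ < r₁ / 250 :=
    nhdsWithin_le_nhds (Iio_mem_nhds (by positivity))
  filter_upwards [hev, self_mem_nhdsWithin] with δ hδr hδ y
  rw [mem_Ioi] at hδ
  obtain ⟨c, hc⟩ := exists_dist_triMeshPoint_le hδ y
  set R₀ : ℝ := r₁ / δ with hR₀
  have hR₀' : 250 ≤ R₀ := by rw [hR₀, le_div_iff₀ hδ]; linarith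
  have hR₀δ : δ * R₀ = r₁ := by rw [hR₀]; field_simp
  set bad : Set (SiteConfig (Site 2)) := ⋂ i < m, (circuitTriple c (circuitScale R₀ (0 + i)))ᶜ with hbad
  have hbadm : MeasurableSet bad := MeasurableSet.iInter fun i ↦ MeasurableSet.iInter fun _ ↦
    (measurableSet_circuitTriple c (circuitScale_nonneg (by linarith) _)).compl
  set G : Set (SiteConfig (Site 2)) := (bad ∪ compl ⁻¹' bad)ᶜ with hG
  refine ⟨G, (hbadm.union (latticeDust_measurable_compl hbadm)).compl, ?_, ?_⟩
  · -- probability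
    have hreal : (triSitePercolation half).real (bad ∪ compl ⁻¹' bad) ≤ κ := by
      refine (latticeDust_real_bad_le hcirc hc₀.le c hR₀' m).trans ?_
      linarith
    change triSitePercolation half (bad ∪ compl ⁻¹' bad)ᶜᶜ ≤ ENNReal.ofReal κ
    rw [compl_compl, ← ENNReal.ofReal_toReal (measure_ne_top _ _)]
    exact ENNReal.ofReal_le_ofReal hreal
  · -- deterministic consequence
    rintro (ω : SiteConfig (Site 2)) hω' i
    have hω : ω ∉ bad ∪ compl ⁻¹' bad := hω'
    rw [mem_union, not_or] at hω
    have hωi : (if i = 1 then ω else ωᶜ) ∉ bad := by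
      split_ifs
      · exact hω.1
      · exact hω.2
    obtain ⟨j, hjm, hj⟩ : ∃ j, j < m ∧
        (if i = 1 then ω else ωᶜ) ∈ circuitTriple c (circuitScale R₀ (0 + j)) := by
      by_contra hcon
      refine hωi (mem_iInter₂.2 fun j hj hmem ↦ ?_)
      exact hcon ⟨j, hj, hmem⟩
    have hRj : R₀ ≤ circuitScale R₀ (0 + j) := le_circuitScale (by linarith) _
    have hRjA : circuitScale R₀ (0 + j) ≤ R₀ * A := by
      rw [circuitScale, hA]
      exact mul_le_mul_of_nonneg_left (pow_le_pow_right₀ (by norm_num) (by omega)) (by linarith)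
    obtain ⟨u, hu, hur, hud⟩ :=
      latticeDust_typed_of_circuitTriple (lt_of_lt_of_le (by norm_num) (hR₀'.trans hRj)) hδ i hj
    refine ⟨u, hu, hur.trans ?_, le_trans ?_ hud⟩
    · -- the ball about `δc` of radius `δ(32 R_j + 2)` lies in `B(y, ρ)`
      intro z hz
      rw [mem_ball] at hz ⊢
      have h1 : δ * (32 * circuitScale R₀ (0 + j) + 2) ≤ ρ / 4 + 2 * δ := by
        have : δ * (32 * circuitScale R₀ (0 + j)) ≤ 32 * (δ * R₀) * A := by nlinarith
        rw [hR₀δ, hr₁A] at this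
        linarith
      have h2 : r₁ ≤ ρ / 128 := by
        rw [hr₁, div_le_div_iff₀ (by positivity) (by positivity)]; nlinarith
      calc dist z y ≤ dist z (triMeshPoint δ c) + dist y (triMeshPoint δ c) := dist_triangle_right _ _ _
        _ < ρ := by linarith
    · calc 4 * r₁ = δ * (4 * R₀) := by rw [← hR₀δ]; ring
        _ ≤ δ * (4 * circuitScale R₀ (0 + j)) := by gcongr

end Summit.CriticalPhenomena.CardyFormulaZ2.Cruxes.NestingRigidity.PositiveConeWeightDoubling

end
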